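import Summits.ValiantsHypothesis.ValiantsHypothesis.Theorems.KPlusLogSqLawTropicalBForcedIncidence

/-!
# Route `KPlusLogSqLaw`, crux `TropicalB` (stmt-ValiantsHypothesis-19771) — the QUIET-CHILD LAW: a forced optimum that survives a step of the
# dominant chain confines that step to the union of its two deviation cycles through the forced column

HONEST FRAMING.  Helper file (cell `pub-symmetroid`, seat val-sym-trop-p5 g27, refuter-adjacent lane, 2026-08-29; `--supports
stmt-ValiantsHypothesis-19771 --as helper`).  A STRUCTURE law valid for every dominance design at every format and every pair of slopes; it is
the corollary of the forced-incidence law (`ForcedIncidence.agree_of_not_sameCycle`, p733507) behind the «no-bypass lemma» of the seat's memo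
LEX-PRODUCT-g27.md §3.8 (evidence on 19771): in the nested-lives reading, a one-deletion sub-block whose optimum does NOT change while the parent
block steps from one dominant term to the next («quiet child») forces the parent's step to stay inside the two exchange cycles, through the deleted
column, along which the child's optimum deviates from the two parent terms.  It bounds nothing for `TropicalB` in its window and bears on neither
`WeakLifting`, DoorA26 / DoorA34, `MatrixDescartes` (stmt-ValiantsHypothesis-18050) nor VP ≠ VNP.

THE LAW.  `p₁` dominant at `θ₁`, `p₂` dominant at `θ₂` (any two slopes), `q` a present term that is optimal among the present terms using
`q`'s row in column `i₀` at BOTH slopes (the quiet child).  Then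
* `step_confined` — every column off the cycle of `i₀` of `p₁.1⁻¹ * q.1` AND off the cycle of `i₀` of `p₂.1⁻¹ * q.1` carries the same
  incidence (row and class) in `p₁` and `p₂`: the step `p₁ → p₂` is confined to the union of the two deviation cycles;
* `step_through_forced_column` — in particular if `p₁` and `p₂` differ at a column `i`, then `i` is on one of the two cycles through `i₀`:
  a step of the parent that avoids both deviation cycles of a quiet child is impossible (equivalently: a step disjoint from them is a
  breakpoint of the child too).
[folklore: two applications of the exchange argument; packaging this seat]
-/

set_option linter.dupNamespace false
set_option autoImplicit false

namespace Summit.ValiantsHypothesis.ValiantsHypothesis.Theorems.KPlusLogSqLaw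

open Summit.ValiantsHypothesis.ValiantsHypothesis.Theorems.MatrixDescartes.Negative

namespace ForcedIncidence

variable {m K : ℕ}

/-- **QUIET-CHILD LAW.**  A forced optimum `q` (row of column `i₀` forced) that is optimal at both `θ₁` (where `p₁` dominates) and `θ₂`
(where `p₂` dominates) makes `p₁` and `p₂` agree at every column lying off both `i₀`-cycles (`p₁.1⁻¹ q.1` and `p₂.1⁻¹ q.1`).
[folklore: exchange argument twice] -/
theorem step_confined (d : Fin K → ℕ) (v ε : Fin m → Fin m → Fin K → ℤ) (θ₁ θ₂ : ℤ)
    {p₁ p₂ q : Equiv.Perm (Fin m) × (Fin m → Fin K)} (hp₁ : IsDominant d v ε θ₁ p₁) (hp₂ : IsDominant d v ε θ₂ p₂)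
    (hq0 : termSign ε q ≠ 0) (i₀ : Fin m)
    (hq₁ : ∀ q' : Equiv.Perm (Fin m) × (Fin m → Fin K), termSign ε q' ≠ 0 → q'.1 i₀ = q.1 i₀ →
      tropWeight d v θ₁ q' ≤ tropWeight d v θ₁ q)
    (hq₂ : ∀ q' : Equiv.Perm (Fin m) × (Fin m → Fin K), termSign ε q' ≠ 0 → q'.1 i₀ = q.1 i₀ →
      tropWeight d v θ₂ q' ≤ tropWeight d v θ₂ q)
    (i : Fin m) (h₁ : ¬ (p₁.1⁻¹ * q.1).SameCycle i₀ i) (h₂ : ¬ (p₂.1⁻¹ * q.1).SameCycle i₀ i) :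
    (p₁.1 i, p₁.2 i) = (p₂.1 i, p₂.2 i) := by
  have e₁ := agree_of_not_sameCycle d v ε θ₁ hp₁ hq0 i₀ hq₁ i h₁
  have e₂ := agree_of_not_sameCycle d v ε θ₂ hp₂ hq0 i₀ hq₂ i h₂
  rw [← e₁, ← e₂]

/-- **No bypass.**  Under the same hypotheses, a column where the two dominant terms differ lies on one of the two `i₀`-cycles of the
quiet child. [folklore] -/
theorem step_through_forced_column (d : Fin K → ℕ) (v ε : Fin m → Fin m → Fin K → ℤ) (θ₁ θ₂ : ℤ)
    {p₁ p₂ q : Equiv.Perm (Fin m) × (Fin m → Fin K)} (hp₁ : IsDominant d v ε θ₁ p₁) (hp₂ : IsDominant d v ε θ₂ p₂)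
    (hq0 : termSign ε q ≠ 0) (i₀ : Fin m)
    (hq₁ : ∀ q' : Equiv.Perm (Fin m) × (Fin m → Fin K), termSign ε q' ≠ 0 → q'.1 i₀ = q.1 i₀ →
      tropWeight d v θ₁ q' ≤ tropWeight d v θ₁ q)
    (hq₂ : ∀ q' : Equiv.Perm (Fin m) × (Fin m → Fin K), termSign ε q' ≠ 0 → q'.1 i₀ = q.1 i₀ →
      tropWeight d v θ₂ q' ≤ tropWeight d v θ₂ q)
    (i : Fin m) (hdiff : (p₁.1 i, p₁.2 i) ≠ (p₂.1 i, p₂.2 i)) :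
    (p₁.1⁻¹ * q.1).SameCycle i₀ i ∨ (p₂.1⁻¹ * q.1).SameCycle i₀ i := by
  by_contra hcon
  push Not at hcon
  exact hdiff (step_confined d v ε θ₁ θ₂ hp₁ hp₂ hq0 i₀ hq₁ hq₂ i hcon.1 hcon.2)

/-- **the quiet child is itself confined**: at every column off its `i₀`-cycle w.r.t. `p₁` it carries `p₁`'s incidence, and off its
`i₀`-cycle w.r.t. `p₂` it carries `p₂`'s — so off both cycles all three terms coincide. [folklore] -/
theorem three_agree (d : Fin K → ℕ) (v ε : Fin m → Fin m → Fin K → ℤ) (θ₁ θ₂ : ℤ)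
    {p₁ p₂ q : Equiv.Perm (Fin m) × (Fin m → Fin K)} (hp₁ : IsDominant d v ε θ₁ p₁) (hp₂ : IsDominant d v ε θ₂ p₂)
    (hq0 : termSign ε q ≠ 0) (i₀ : Fin m)
    (hq₁ : ∀ q' : Equiv.Perm (Fin m) × (Fin m → Fin K), termSign ε q' ≠ 0 → q'.1 i₀ = q.1 i₀ →
      tropWeight d v θ₁ q' ≤ tropWeight d v θ₁ q)
    (hq₂ : ∀ q' : Equiv.Perm (Fin m) × (Fin m → Fin K), termSign ε q' ≠ 0 → q'.1 i₀ = q.1 i₀ →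
      tropWeight d v θ₂ q' ≤ tropWeight d v θ₂ q)
    (i : Fin m) (h₁ : ¬ (p₁.1⁻¹ * q.1).SameCycle i₀ i) (h₂ : ¬ (p₂.1⁻¹ * q.1).SameCycle i₀ i) :
    (q.1 i, q.2 i) = (p₁.1 i, p₁.2 i) ∧ (q.1 i, q.2 i) = (p₂.1 i, p₂.2 i) :=
  ⟨agree_of_not_sameCycle d v ε θ₁ hp₁ hq0 i₀ hq₁ i h₁, agree_of_not_sameCycle d v ε θ₂ hp₂ hq0 i₀ hq₂ i h₂⟩

end ForcedIncidence

end Summit.ValiantsHypothesis.ValiantsHypothesis.Theorems.KPlusLogSqLaw
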